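import Summits.QuantumFields.YangMills.Theorems.VirialFluxGapRingZeroSetOrbits
import Summits.QuantumFields.YangMills.Theorems.VirialFluxGapRingTreeGauge
import Summits.QuantumFields.YangMills.Theorems.LuscherReductionRunningReductionCombGaugeBox
import Summits.QuantumFields.YangMills.Theorems.LuscherReductionRunningReductionAxialGaugeInner
import HarnessLib

/-!
# The zero set of the twisted deficit IN TREE GAUGE: four orbits of the residual constant `SU(2)`
# (layer (B1)+(B2) junction of the DIRECT Laplace road to ⟨stmt-QuantumFields-24204⟩ `VirialFluxGap.SharpTwistedLaplace`)

Helper module (free-hands work of width seat ym-line-sfw-p2-w2 g49, cell ym-idea-1).  On the reduced space of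
✓`VirialFluxGapRingTreeGauge` (slice `0` glued from its off-tree links `w`, the other slices `f`, the seam `g`) the phase
`F_z(glue w ∷ f, g)` vanishes EXACTLY on the orbits of the CONSTANT `SU(2)` through the sign-class twist-eater rings:
* `combFlat_apply_of_tree`, `treeGauge_combFlat`, `treeFix_combFlat` — a comb-flat configuration is its own comb gauge;
* `const_of_gaugeTransform_combFlat_eq_glue` — if `h · combFlat W = glue w` then `h` is CONSTANT (`h x = h 0`): comb gauge is a complete
  gauge fixing modulo constants (`treeGauge_gaugeTransform`, `treeGauge_glue`);
* ★ `ringDeficit_treeGauge_eq_zero_iff` — `F_z(glue w ∷ f, g) = 0 ↔ ∃ s k, glue w = k·combFlat W_s ∧ (∀ j, f_j = k·combFlat W_s) ∧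
  g = k (λ C₀) k⁻¹` with `k ∈ SU(2)` a CONSTANT gauge transformation and `W_s(k) = centreElem(s_k)·(N₀ if z_k else 1)`.
So the critical set of the reduced Laplace integral is `⋃_s SU(2)·Q_s` — compact 3-dimensional orbits (stabiliser `{±1}`) of a FIXED Lie
group, with explicit representatives and the `O(1)` transversality of ✓`VirialFluxGapResidualTransversality`.  Everything here is PROVED;
no definitions, no named facts.  HONEST FRAMING: algebra∕bookkeeping; ⟨24204⟩, ⟨24319⟩ and every rung stay OPEN; the Yang–Mills mass gap
(Clay) is NOT touched; no summit is proved by a line.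
-/

noncomputable section

open scoped Quaternion Matrix BigOperators
open Literature.MathematicalPhysics.QuantumFieldTheory hiding SU2 su2Quat_mul
open Literature.MathematicalPhysics.QuantumLattice
open Summit.QuantumFields.YangMills.Theorems.FemtoTransferGap
open Summit.QuantumFields.YangMills.Theorems.FemtoTransferGap.TT
open Summit.QuantumFields.YangMills.Theorems.FemtoTransferGap.TwoLattice
open Summit.QuantumFields.YangMills.Theorems.FemtoTransferGap.TwoLattice.Flat
open Summit.QuantumFields.YangMills.Theorems.QuantitativeLaplace

namespace Summit.QuantumFields.YangMills.Theorems.VirialFluxGap.RingDeficit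

variable {L : ℕ} [NeZero L]

/-! ## §1 Comb-flat configurations are comb-gauged -/

omit [NeZero L] in
/-- Tree links of a comb-flat configuration are trivial (the comb tree avoids the wrapping links `x_k = −1`). [folklore] -/
theorem combFlat_apply_of_tree (W : Fin 3 → SU2) {e : Edge 3 L} (he : treeEdge e = true) : combFlat W e = 1 := by
  rw [combFlat_apply]
  rw [treeEdge_iff] at he
  have hne : e.1 e.2 ≠ -1 := by
    rcases he with ⟨h2, h⟩ | ⟨h2, -, h⟩ | ⟨h2, -, -, h⟩ <;> rwa [h2]
  rw [if_neg hne]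

/-- The comb transporter of a comb-flat configuration is `1`. [folklore] -/
theorem treeGauge_combFlat (W : Fin 3 → SU2) (x : Site 3 L) : treeGauge (combFlat W) x = 1 := by
  rw [treeGauge_congr (U' := fun _ : Edge 3 L => (1 : SU2)) (fun e he => combFlat_apply_of_tree W he) x, treeGauge_one]

/-- A comb-flat configuration is its own comb gauge. [folklore] -/
theorem treeFix_combFlat (W : Fin 3 → SU2) : treeFix (combFlat (L := L) W) = combFlat W := by
  funext e
  show treeGauge (combFlat W) e.1 * combFlat W e * (treeGauge (combFlat W) (e.1.shift e.2))⁻¹ = combFlat W e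
  rw [treeGauge_combFlat, treeGauge_combFlat, one_mul, inv_one, mul_one]

/-- **Comb gauge is complete modulo constants**: if `h · combFlat W` is glued (comb-gauged) then `h` is constant. [folklore] -/
theorem const_of_gaugeTransform_combFlat_eq_glue {h : Site 3 L → SU2} {W : Fin 3 → SU2} {w : OffIdx L → SU2}
    (hw : gaugeTransform h (combFlat W) = glue w) (x : Site 3 L) : h x = h 0 := by
  have h1 : treeGauge (gaugeTransform h (combFlat W)) x = 1 := by rw [hw, treeGauge_glue]
  rw [treeGauge_gaugeTransform, treeGauge_combFlat, mul_one, mul_inv_eq_one] at h1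
  exact h1.symm

/-! ## §2 The zero set in tree gauge -/

/-- ★ **The zero set of the twisted deficit in tree gauge = the residual-`SU(2)` orbits of the sign-class twist-eater rings.**
[cite: Luscher1983, §2] [cite: GonzalezarroyoAltes1988, §2] -/
theorem ringDeficit_treeGauge_eq_zero_iff (hL : 2 ≤ L) (z : Fin 3 → Bool) (hz : z ≠ fun _ => false)
    {lam : Site 3 L → SU2} (hlamc : ∀ x, lam x ∈ Subgroup.center SU2) (hlam0 : lam 0 = 1)
    (hlamflip : ∀ (x : Site 3 L) (k : Fin 3), (x k = 0 ∨ x k = -1) → lam (x.shift k) = lam x * centreElem (z k))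
    (hlamstay : ∀ (x : Site 3 L) (k : Fin 3), x k ≠ 0 → x k ≠ -1 → lam (x.shift k) = lam x)
    {N₀ C₀ : SU2} (hN : (su2Quat N₀).re = 0) (hC : (su2Quat C₀).re = 0)
    (hNC : (su2Quat N₀).imI * (su2Quat C₀).imI + (su2Quat N₀).imJ * (su2Quat C₀).imJ + (su2Quat N₀).imK * (su2Quat C₀).imK = 0)
    (w : OffIdx L → SU2) (f : Fin (2 * L - 1) → GaugeConfig 3 L SU2) (g : Site 3 L → SU2) :
    ringDeficit L z ((Fin.cons (glue w) f : Fin (2 * L - 1 + 1) → GaugeConfig 3 L SU2), g) = 0 ↔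
      ∃ (s : Fin 3 → Bool) (k : SU2),
        glue w = gaugeTransform (fun _ : Site 3 L => k) (combFlat fun i => centreElem (s i) * (if z i then N₀ else 1)) ∧
        (∀ j, f j = gaugeTransform (fun _ : Site 3 L => k) (combFlat fun i => centreElem (s i) * (if z i then N₀ else 1))) ∧
        g = fun x => k * (lam x * C₀) * k⁻¹ := by
  rw [ringDeficit_eq_zero_iff_exists_gauge_signClass hL z hz hlamc hlam0 hlamflip hlamstay hN hC hNC]
  constructor
  · rintro ⟨s, h, hP⟩
    obtain ⟨h1, h2⟩ := Prod.ext_iff.mp hP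
    simp only at h1 h2
    have h10 : glue w = gaugeTransform h (combFlat fun i => centreElem (s i) * (if z i then N₀ else 1)) := by
      have := congrFun h1 0
      simpa only [Fin.cons_zero] using this
    have hconst : ∀ x, h x = h 0 := const_of_gaugeTransform_combFlat_eq_glue h10.symm
    have hh : h = fun _ => h 0 := funext hconst
    refine ⟨s, h 0, ?_, fun j => ?_, ?_⟩
    · rw [h10, ← hh]
    · have := congrFun h1 j.succ
      simp only [Fin.cons_succ] at this
      rw [this, ← hh]
    · rw [h2]
      funext x
      simp only [Pi.mul_apply, Pi.inv_apply, hconst x]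
  · rintro ⟨s, k, hw, hf, hg⟩
    refine ⟨s, fun _ => k, Prod.ext ?_ ?_⟩
    · funext i
      refine Fin.cases ?_ (fun j => ?_) i
      · simp only [Fin.cons_zero, hw]
      · simp only [Fin.cons_succ, hf j]
    · rw [hg]
      funext x
      simp only [Pi.mul_apply, Pi.inv_apply]

end Summit.QuantumFields.YangMills.Theorems.VirialFluxGap.RingDeficit
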